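import Literature.AnabelianGeometry.SemiGraphs.SubgroupPresentationCosetGraph
import Literature.AnabelianGeometry.SemiGraphs.SubdivisionLemmas
import HarnessLib

/-!
# A connected coset semi-graph forces `Γ = ⟨H_w, s_b⟩ · K` ([SemiAnbd] Prop 3.6 p. 38, Rmk 2.2.1 p. 24, §5 p. 65; classical Bass–Serre)

Mochizuki, *Semi-graphs of anabelioids*, Publ. RIMS **42** (2006), §3, Prop. 3.6 p. 38 (the tower
`𝒢_{∞,i} → 𝒢_i → 𝒢` and its groups `Gal(𝒢_{∞,i}/𝒢)`) [cite: MochizukiSemiAnbd2006, Prop 3.6 p.38], Rmk. 2.2.1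
p. 24 (decomposition groups as stabilisers, referring to [Serre, *Trees*] Ch. I)
[cite: MochizukiSemiAnbd2006, Rem. 2.2.1 p.24] and §5 p. 65 (the verticial subgroups `Π^temp_{𝔊,v} ⊆ Π^temp_𝔊`
and the branch inclusions, "well-defined up to conjugation").  The statement proved here is NOT printed
in [SemiAnbd]: it is the generation half of the classical Bass–Serre structure theorem (Serre, *Trees*,
I §5.4 Thm 13: the fundamental group of a graph of groups is generated by the vertex groups of a
fundamental domain and the edge translators), run in abc-iut-L3-d4's coset-semigraph currency.  (v2:
attribution re-anchored per referee lane A pass A21, finding F4 — doc-only; statements and proofs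
byte-identical to v1 p431666.)

PURE GROUP THEORY + SEMI-GRAPH COMBINATORICS in abc-iut-L3-d4's coset-semigraph currency
(`SubgroupPresentation.cosetGraph`; cell row T54-B, plan/GAP-LEDGER.md G-w4d053-1, sub-row T54·E1b input
«`π₁^temp(𝒢)` topologically finitely generated»).  For a subgroup presentation `P` of `𝔾` in `Γ`, a level
`K ≤ Γ` (ANY subgroup — no normality) and any subgroup `Λ ≤ Γ` containing every vertex group `H_w` and every
branch element `s_b`:

* `SubgroupPresentation.good_of_adj` — in the barycentric subdivision of `P.cosetGraph K`, the nodes having a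
  representative in `Λ` (`H_w γ K`, `M_e γ K`, their branches, `γ ∈ Λ`) are closed under adjacency: the
  branches of `M_e γ K` abut to `H_w (s_b γ) K`, and a branch abutting to `H_w γ K` is `bMk b (s_b⁻¹ h γ)`;
* **`SubgroupPresentation.exists_mem_mul_of_isConnected`** / **`sup_eq_top_of_isConnected`** — if
  `P.cosetGraph K` is CONNECTED and `𝔾` has a vertex, then every `g ∈ Γ` is `γ k` with `γ ∈ Λ`, `k ∈ K`,
  i.e. `Λ ⊔ K = ⊤`: the level `K` together with the vertex groups and branch elements generates `Γ`.

Nothing here refers to the IUT corpus; no side is taken on [IUTchIII] Cor 3.12.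
-/

namespace Literature.AnabelianGeometry.SemiGraphs

namespace SemiGraph

namespace SubgroupPresentation

open CategoryTheory

universe u

variable {𝔾 : SemiGraph.{u}} {Γ : Type u} [Group Γ] (P : SubgroupPresentation 𝔾 Γ) (K : Subgroup Γ)

/-- Right `K`-invariance of branch representatives: `bMk b (y k) = bMk b y` for `k ∈ K`.
[cite: MochizukiSemiAnbd2006, Rem. 2.2.1 p.24] -/
theorem bMk_mul_of_mem (b : 𝔾.Branch) (y : Γ) {k : Γ} (hk : k ∈ K) :
    P.bMk K b (y * k) = P.bMk K b y := by
  have h : DoubleCoset.mk (P.M (𝔾.edgeOf b)) K (y * k) = DoubleCoset.mk (P.M (𝔾.edgeOf b)) K y :=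
    (DoubleCoset.eq _ _ _ _).mpr ⟨1, one_mem _, k⁻¹, K.inv_mem hk, by group⟩
  exact Subtype.ext (Prod.ext rfl (congrArg (Sigma.mk (𝔾.edgeOf b)) h))

/-- Left `M_e`-invariance of branch representatives: `bMk b (m y) = bMk b y` for `m ∈ M_{e(b)}`.
[cite: MochizukiSemiAnbd2006, Rem. 2.2.1 p.24] -/
theorem bMk_mul_of_mem_left (b : 𝔾.Branch) (y : Γ) {m : Γ} (hm : m ∈ P.M (𝔾.edgeOf b)) :
    P.bMk K b (m * y) = P.bMk K b y := by
  have h : DoubleCoset.mk (P.M (𝔾.edgeOf b)) K (m * y) = DoubleCoset.mk (P.M (𝔾.edgeOf b)) K y :=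
    (DoubleCoset.eq _ _ _ _).mpr ⟨m⁻¹, (P.M _).inv_mem hm, 1, one_mem _, by group⟩
  exact Subtype.ext (Prod.ext rfl (congrArg (Sigma.mk (𝔾.edgeOf b)) h))

/-- The edge of a branch representative. [cite: MochizukiSemiAnbd2006, Rem. 2.2.1 p.24] -/
theorem edgeOf_bMk (b : 𝔾.Branch) (y : Γ) :
    (P.cosetGraph K).edgeOf (P.bMk K b y) = P.eMk K (𝔾.edgeOf b) y := rfl

variable (Λ : Subgroup Γ)

/-- **The `Λ`-represented nodes are closed under adjacency** (`Λ ⊇ H_w, s_b`): along `vertex ← branch`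
use `H_w s_b y K = H_w γ K ⇒ bMk b y = bMk b (s_b⁻¹ h⁻¹ γ)`; along `edge → branch` the same
representative; along `branch → vertex` the representative `s_b γ`. [cite: MochizukiSemiAnbd2006, Rem. 2.2.1 p.24] -/
theorem good_of_adj (hH : ∀ w, P.H w ≤ Λ) (hs : ∀ b, P.s b ∈ Λ) {n n' : (P.cosetGraph K).Node}
    (hadj : (P.cosetGraph K).subdivision.Adj n n')
    (hn : (∃ w, ∃ γ ∈ Λ, n = Sum.inl (P.vMk K w γ)) ∨ (∃ e, ∃ γ ∈ Λ, n = Sum.inr (Sum.inl (P.eMk K e γ))) ∨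
      ∃ b, ∃ γ ∈ Λ, n = Sum.inr (Sum.inr (P.bMk K b γ))) :
    (∃ w, ∃ γ ∈ Λ, n' = Sum.inl (P.vMk K w γ)) ∨ (∃ e, ∃ γ ∈ Λ, n' = Sum.inr (Sum.inl (P.eMk K e γ))) ∨
      ∃ b, ∃ γ ∈ Λ, n' = Sum.inr (Sum.inr (P.bMk K b γ)) := by
  rcases hn with ⟨w, γ, hγ, rfl⟩ | ⟨e, γ, hγ, rfl⟩ | ⟨b, γ, hγ, rfl⟩
  · -- a vertex node `H_w γ K`: its neighbours are the branches abutting to it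
    obtain ⟨x, hx, rfl⟩ := ((P.cosetGraph K).subdivision_adj_inl_iff _ n').1 hadj
    obtain ⟨b, y, rfl⟩ := P.bMk_surjective K x
    refine Or.inr (Or.inr ⟨b, ?_⟩)
    rcases hab : 𝔾.abuts b with _ | w'
    · rw [P.cosetGraph_abuts_bMk_none K b hab y] at hx
      exact absurd hx (by simp)
    · rw [P.cosetGraph_abuts_bMk K b w' hab y] at hx
      have hx' := Option.some.inj hx
      obtain ⟨rfl, h2⟩ := Sigma.mk.inj_iff.mp hx'
      have h3 : DoubleCoset.mk (P.H w') K (P.s b * y) = DoubleCoset.mk (P.H w') K γ := eq_of_heq h2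
      obtain ⟨h, hh, k, hk, hγ'⟩ := (DoubleCoset.eq _ _ _ _).mp h3
      -- `γ = h (s_b y) k`, so `y = s_b⁻¹ h⁻¹ γ k⁻¹`
      refine ⟨(P.s b)⁻¹ * h⁻¹ * γ, Λ.mul_mem (Λ.mul_mem (Λ.inv_mem (hs b)) (Λ.inv_mem (hH w' hh))) hγ,
        ?_⟩
      have hy : y = (P.s b)⁻¹ * h⁻¹ * γ * k⁻¹ := by rw [hγ']; group
      rw [hy, P.bMk_mul_of_mem K b _ (K.inv_mem hk)]
  · -- an edge node `M_e γ K`: its neighbours are its branches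
    obtain ⟨x, hx, rfl⟩ := ((P.cosetGraph K).subdivision_adj_edge_iff _ n').1 hadj
    obtain ⟨b, y, rfl⟩ := P.bMk_surjective K x
    refine Or.inr (Or.inr ⟨b, γ, hγ, ?_⟩)
    rw [P.edgeOf_bMk] at hx
    obtain ⟨rfl, h2⟩ := Sigma.mk.inj_iff.mp hx
    have h3 : DoubleCoset.mk (P.M (𝔾.edgeOf b)) K y = DoubleCoset.mk (P.M (𝔾.edgeOf b)) K γ :=
      eq_of_heq h2
    exact congrArg (fun z => Sum.inr (Sum.inr z))
      (Subtype.ext (Prod.ext rfl (congrArg (Sigma.mk (𝔾.edgeOf b)) h3)))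
  · -- a branch node: its edge, or the vertex it abuts to
    rcases ((P.cosetGraph K).subdivision_adj_branch_iff _ n').1 hadj with rfl | ⟨v, hv, rfl⟩
    · exact Or.inr (Or.inl ⟨𝔾.edgeOf b, γ, hγ, rfl⟩)
    · refine Or.inl ?_
      rcases hab : 𝔾.abuts b with _ | w
      · rw [P.cosetGraph_abuts_bMk_none K b hab γ] at hv
        exact absurd hv (by simp)
      · rw [P.cosetGraph_abuts_bMk K b w hab γ] at hv
        exact ⟨w, P.s b * γ, Λ.mul_mem (hs b) hγ, congrArg Sum.inl (Option.some.inj hv).symm⟩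

/-- **Every node of a CONNECTED coset semi-graph has a representative in `Λ`** (`Λ ⊇ H_w, s_b`; `𝔾` with a
vertex `w₀`, whose class `H_{w₀} 1 K` starts the walk). [cite: MochizukiSemiAnbd2006, Rem. 2.2.1 p.24] -/
theorem good_of_isConnected (hH : ∀ w, P.H w ≤ Λ) (hs : ∀ b, P.s b ∈ Λ)
    (hK : (P.cosetGraph K).IsConnected) (w₀ : 𝔾.Vertex) (n : (P.cosetGraph K).Node) :
    (∃ w, ∃ γ ∈ Λ, n = Sum.inl (P.vMk K w γ)) ∨ (∃ e, ∃ γ ∈ Λ, n = Sum.inr (Sum.inl (P.eMk K e γ))) ∨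
      ∃ b, ∃ γ ∈ Λ, n = Sum.inr (Sum.inr (P.bMk K b γ)) := by
  obtain ⟨p⟩ := hK.connected.preconnected (Sum.inl (P.vMk K w₀ 1)) n
  -- propagate along a walk from the class `H_{w₀} 1 K`
  have key : ∀ (u v : (P.cosetGraph K).Node) (q : (P.cosetGraph K).subdivision.Walk u v),
      ((∃ w, ∃ γ ∈ Λ, u = Sum.inl (P.vMk K w γ)) ∨ (∃ e, ∃ γ ∈ Λ, u = Sum.inr (Sum.inl (P.eMk K e γ))) ∨
        ∃ b, ∃ γ ∈ Λ, u = Sum.inr (Sum.inr (P.bMk K b γ))) →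
      ((∃ w, ∃ γ ∈ Λ, v = Sum.inl (P.vMk K w γ)) ∨ (∃ e, ∃ γ ∈ Λ, v = Sum.inr (Sum.inl (P.eMk K e γ))) ∨
        ∃ b, ∃ γ ∈ Λ, v = Sum.inr (Sum.inr (P.bMk K b γ))) := by
    intro u v q
    induction q with
    | nil => exact id
    | cons hadj q ih => exact fun hu => ih (P.good_of_adj K Λ hH hs hadj hu)
  exact key _ _ p (Or.inl ⟨w₀, 1, one_mem _, rfl⟩)

/-- **A connected coset semi-graph forces `Γ = Λ · K`** for any `Λ` containing the vertex groups and the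
branch elements: every `g ∈ Γ` is `γ · k` with `γ ∈ Λ`, `k ∈ K` (read off at the vertex `H_{w₀} g K`).
[cite: MochizukiSemiAnbd2006, Rem. 2.2.1 p.24] -/
theorem exists_mem_mul_of_isConnected (hH : ∀ w, P.H w ≤ Λ) (hs : ∀ b, P.s b ∈ Λ)
    (hK : (P.cosetGraph K).IsConnected) (w₀ : 𝔾.Vertex) (g : Γ) :
    ∃ γ ∈ Λ, ∃ k ∈ K, g = γ * k := by
  rcases P.good_of_isConnected K Λ hH hs hK w₀ (Sum.inl (P.vMk K w₀ g)) with
    ⟨w, γ, hγ, h⟩ | ⟨e, γ, -, h⟩ | ⟨b, γ, -, h⟩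
  · have h1 := Sum.inl_injective h
    obtain ⟨rfl, h2⟩ := Sigma.mk.inj_iff.mp h1
    have h3 : DoubleCoset.mk (P.H w₀) K g = DoubleCoset.mk (P.H w₀) K γ := eq_of_heq h2
    obtain ⟨a, ha, k, hk, hγ'⟩ := (DoubleCoset.eq _ _ _ _).mp h3
    -- `γ = a g k`, so `g = (a⁻¹ γ) k⁻¹`
    exact ⟨a⁻¹ * γ, Λ.mul_mem (Λ.inv_mem (hH w₀ ha)) hγ, k⁻¹, K.inv_mem hk, by rw [hγ']; group⟩
  · exact absurd h (by simp)
  · exact absurd h (by simp)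

/-- **`Λ ⊔ K = ⊤`**: a level with connected coset semi-graph, together with the vertex groups and the branch
elements, generates `Γ`. [cite: MochizukiSemiAnbd2006, Rem. 2.2.1 p.24] -/
theorem sup_eq_top_of_isConnected (hH : ∀ w, P.H w ≤ Λ) (hs : ∀ b, P.s b ∈ Λ)
    (hK : (P.cosetGraph K).IsConnected) (w₀ : 𝔾.Vertex) : Λ ⊔ K = ⊤ := by
  refine top_le_iff.mp fun g _ => ?_
  obtain ⟨γ, hγ, k, hk, rfl⟩ := P.exists_mem_mul_of_isConnected K Λ hH hs hK w₀ g
  exact Subgroup.mul_mem _ (Subgroup.mem_sup_left hγ) (Subgroup.mem_sup_right hk)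

end SubgroupPresentation

end SemiGraph

end Literature.AnabelianGeometry.SemiGraphs
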